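import Summits.CriticalPhenomena.CardyFormulaZ2.Theses.CardyUSTContinuation
import Summits.CriticalPhenomena.CardyFormulaZ2.Theorems.CardyUSTContinuationUniformAnalyticExtensionStubRatioToCrux
import Literature.Probability.LatticeModels.FKTwoArcPartitionPolynomials
import HarnessLib

/-!
# Stub `stub_derivBoundsToRatioBound` of the line `registered` (birth skeleton v8) for the crux
# `UniformAnalyticExtension` (stmt-CriticalPhenomena-6047, route `CardyUSTContinuation`)

The ENGINE of skeleton v8.  Write `N_δ = fkTwoArcCrossingPolynomial R δ .joint`,
`Z_δ = fkTwoArcPartitionPolynomials R δ .joint` (both in `ℕ[X]`) and `f_δ z = N_δ(z) / Z_δ(z)` for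
the junk-valued complex crossing ratio.  We prove: δ-uniform Gevrey-1 bounds
`‖f_δ^{(k)}(t)‖ ≤ M · k! / rᵏ` at the REAL points `t ∈ [t₁, 1]` (all orders `k`, all small `δ`)
imply a δ-uniform bound of `f_δ` on the complex `r/2`-neighbourhood of `[t₁, 1]` — the normal form
`ratioBound` of the crux, which implies the crux by the landed `stub_ratioToCrux`.

Pure complex analysis.  For `t ∈ [t₁, 1]` we have `Z_δ(t) > 0`, so `f_δ` is holomorphic near `t`;
its Taylor series at `t` has radius `≥ r` by the coefficient bounds and sums to a holomorphic `F_t`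
on `ball t r` with `‖F_t‖ ≤ 2M` on `ball t (r/2)` (geometric series) and `F_t = f_δ` near `t`
(`Complex.hasSum_taylorSeries_on_ball`).  By the identity theorem on the (convex) ball,
`F_t · Z_δ = N_δ` on `ball t r`, hence `f_δ = F_t` off the zeros of `Z_δ`; at the zeros of `Z_δ`
the junk value of `f_δ` is `0`.
-/

noncomputable section

open Filter Topology Set Polynomial Metric
open Literature.Probability.LatticeModels
open Literature.Probability.RandomPlanarGeometry (ConformalRectangle)

namespace Summit.CriticalPhenomena.CardyFormulaZ2.Cruxes.UniformAnalyticExtension.Birth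

/-- **Power series with geometrically bounded coefficients.** If `‖a n‖ ≤ M / rⁿ` for all `n`
(`r > 0`), then `∑ a n · yⁿ` sums, on `ball 0 r`, to a function holomorphic on `ball 0 r` and
bounded by `2M` on `ball 0 (r/2)`. [folklore] -/
theorem derivBoundsToRatioBound_series {a : ℕ → ℂ} {r M : ℝ} (hr : 0 < r)
    (ha : ∀ n, ‖a n‖ ≤ M / r ^ n) :
    ∃ F : ℂ → ℂ, DifferentiableOn ℂ F (ball 0 r) ∧
      (∀ y ∈ ball (0:ℂ) r, HasSum (fun n => a n * y ^ n) (F y)) ∧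
      ∀ y ∈ ball (0:ℂ) (r / 2), ‖F y‖ ≤ 2 * M := by
  have hM : 0 ≤ M := by
    have h := ha 0
    rw [pow_zero, div_one] at h
    exact (norm_nonneg _).trans h
  lift r to NNReal using hr.le
  set p : FormalMultilinearSeries ℂ ℂ ℂ := FormalMultilinearSeries.ofScalars ℂ a with hpdef
  have hpn : ∀ n, ‖p n‖ = ‖a n‖ := fun n => by
    rw [hpdef]
    exact FormalMultilinearSeries.ofScalars_norm ℂ a n
  have hrad : (r : ENNReal) ≤ p.radius := by
    refine p.le_radius_of_bound M fun n => ?_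
    rw [hpn]
    calc ‖a n‖ * (r : ℝ) ^ n ≤ M / (r : ℝ) ^ n * (r : ℝ) ^ n :=
          mul_le_mul_of_nonneg_right (ha n) (pow_nonneg hr.le n)
      _ = M := div_mul_cancel₀ _ (pow_ne_zero _ hr.ne')
  have hr' : (0 : ENNReal) < r := ENNReal.coe_pos.2 (NNReal.coe_pos.1 hr)
  have hp : HasFPowerSeriesOnBall p.sum p 0 p.radius :=
    p.hasFPowerSeriesOnBall (hr'.trans_le hrad)
  have hball : ball (0:ℂ) r ⊆ Metric.eball 0 p.radius := by
    intro y hy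
    apply Metric.eball_subset_eball hrad
    rwa [Metric.eball_coe]
  have hsum : ∀ y ∈ ball (0:ℂ) r, HasSum (fun n => a n * y ^ n) (p.sum y) := by
    intro y hy
    have hfun : (fun n => p n fun _ => y) = fun n => a n * y ^ n := by
      funext n
      rw [hpdef, FormalMultilinearSeries.ofScalars_apply_eq, smul_eq_mul]
    have h := p.hasSum (hball hy)
    rwa [hfun] at h
  have hgeom : HasSum (fun n : ℕ => M * (1 / 2 : ℝ) ^ n) (2 * M) := by
    have h := hasSum_geometric_two.mul_left M
    rwa [mul_comm M 2] at h
  refine ⟨p.sum, hp.differentiableOn.mono hball, hsum, fun y hy => ?_⟩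
  have hyn : ‖y‖ < r / 2 := mem_ball_zero_iff.1 hy
  have hyr : y ∈ ball (0:ℂ) r := mem_ball_zero_iff.2 (hyn.trans (half_lt_self hr))
  refine (hsum y hyr).norm_le_of_bounded hgeom fun n => ?_
  rw [norm_mul, norm_pow]
  calc ‖a n‖ * ‖y‖ ^ n ≤ M / (r : ℝ) ^ n * ((r : ℝ) / 2) ^ n :=
        mul_le_mul (ha n) (pow_le_pow_left₀ (norm_nonneg _) hyn.le n) (by positivity)
          (div_nonneg hM (pow_nonneg hr.le n))
    _ = M * (1 / 2) ^ n := by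
        have hrn : (r : ℝ) ^ n ≠ 0 := pow_ne_zero _ hr.ne'
        rw [div_pow, div_mul_div_comm, mul_comm ((r : ℝ) ^ n) ((2 : ℝ) ^ n),
          mul_div_mul_right _ _ hrn, one_div, inv_pow, div_eq_mul_inv]

/-- **Gevrey bounds at a point give a bounded holomorphic extension to a fixed ball.** If `f` is
holomorphic near `c` and `‖f^{(k)}(c)‖ ≤ M · k! / rᵏ` for all `k` (`r > 0`), then there is `F`
holomorphic on `ball c r`, equal to `f` near `c`, with `‖F‖ ≤ 2M` on `ball c (r/2)` (the sum of
the Taylor series of `f` at `c`). [folklore] -/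
theorem derivBoundsToRatioBound_extension {f : ℂ → ℂ} {c : ℂ} {ε r M : ℝ} (hε : 0 < ε)
    (hr : 0 < r) (hf : DifferentiableOn ℂ f (ball c ε))
    (hb : ∀ k : ℕ, ‖iteratedDeriv k f c‖ ≤ M * k.factorial / r ^ k) :
    ∃ F : ℂ → ℂ, DifferentiableOn ℂ F (ball c r) ∧ F =ᶠ[𝓝 c] f ∧
      ∀ z ∈ ball c (r / 2), ‖F z‖ ≤ 2 * M := by
  have ha : ∀ n : ℕ, ‖((n.factorial : ℕ) : ℂ)⁻¹ * iteratedDeriv n f c‖ ≤ M / r ^ n := by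
    intro n
    have hn : (0:ℝ) < (n.factorial : ℕ) := by exact_mod_cast n.factorial_pos
    rw [norm_mul, norm_inv, Complex.norm_natCast, inv_mul_le_iff₀ hn]
    calc ‖iteratedDeriv n f c‖ ≤ M * n.factorial / r ^ n := hb n
      _ = n.factorial * (M / r ^ n) := by ring
  obtain ⟨F₀, hF₀d, hF₀s, hF₀b⟩ := derivBoundsToRatioBound_series hr ha
  have hmaps : MapsTo (fun w : ℂ => w - c) (ball c r) (ball 0 r) := fun w hw =>
    mem_ball_zero_iff.2 (mem_ball_iff_norm.1 hw)
  refine ⟨fun w => F₀ (w - c), hF₀d.comp (differentiableOn_id.sub_const c) hmaps, ?_, ?_⟩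
  · filter_upwards [ball_mem_nhds c (lt_min hε hr)] with w hw
    have hwε : w ∈ ball c ε := ball_subset_ball (min_le_left _ _) hw
    have hwr : w - c ∈ ball (0:ℂ) r := hmaps (ball_subset_ball (min_le_right _ _) hw)
    have h1 := Complex.hasSum_taylorSeries_on_ball hf hwε
    have hfun : (fun n : ℕ => ((n.factorial : ℕ) : ℂ)⁻¹ • (w - c) ^ n • iteratedDeriv n f c) =
        fun n : ℕ => ((n.factorial : ℕ) : ℂ)⁻¹ * iteratedDeriv n f c * (w - c) ^ n := by
      funext n
      simp only [smul_eq_mul]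
      ring
    rw [hfun] at h1
    exact (hF₀s _ hwr).unique h1
  · intro z hz
    exact hF₀b _ (mem_ball_zero_iff.2 (mem_ball_iff_norm.1 hz))

/-- **stub_derivBoundsToRatioBound** (ENGINE of skeleton v8 for the crux `UniformAnalyticExtension`):
δ-uniform Gevrey-1 bounds `‖f_δ^{(k)}(t)‖ ≤ M · k!/rᵏ` for the junk-valued crossing ratio
`f_δ = N_δ/Z_δ` at the real points of `[t₁, 1]` give the δ-uniform bound `max (2M) 0` of `f_δ` on
the complex `r/2`-neighbourhood of `[t₁, 1]` (Taylor series at the real points: radius `≥ r`, sum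
`≤ 2M` on the half ball, `= f_δ` off the zeros of `Z_δ` by the identity theorem `F_t · Z_δ = N_δ`;
junk value `0` at the zeros). [folklore] -/
theorem stub_derivBoundsToRatioBound :
    (∀ R : ConformalRectangle, ∀ t₁ ∈ Set.Ioo (0:ℝ) 1, ∃ r > (0:ℝ), ∃ M : ℝ, ∀ᶠ δ in 𝓝[>] (0:ℝ),
      ∀ k : ℕ, ∀ t ∈ Set.Icc t₁ 1,
        ‖iteratedDeriv k (fun z : ℂ => aeval z (fkTwoArcCrossingPolynomial R δ ArcWiring.joint) /
            aeval z (fkTwoArcPartitionPolynomials R δ ArcWiring.joint)) (t : ℂ)‖ ≤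
          M * k.factorial / r ^ k) →
    ∀ R : ConformalRectangle, ∀ t₁ ∈ Set.Ioo (0:ℝ) 1, ∃ ρ > (0:ℝ), ∃ M : ℝ, ∀ᶠ δ in 𝓝[>] (0:ℝ),
      ∀ z ∈ thickening ρ (((↑) : ℝ → ℂ) '' Set.Icc t₁ 1),
        ‖aeval z (fkTwoArcCrossingPolynomial R δ ArcWiring.joint) /
            aeval z (fkTwoArcPartitionPolynomials R δ ArcWiring.joint)‖ ≤ M := by
  intro h R t₁ ht₁
  obtain ⟨r, hr, M, hev⟩ := h R t₁ ht₁
  refine ⟨r / 2, half_pos hr, max (2 * M) 0, ?_⟩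
  filter_upwards [hev, self_mem_nhdsWithin] with δ hδ hδpos
  have hδ' : (0:ℝ) < δ := hδpos
  intro z hz
  obtain ⟨_, ⟨t, ht, rfl⟩, hzt⟩ := mem_thickening_iff.1 hz
  have ht0 : 0 < t := ht₁.1.trans_le ht.1
  set N := fkTwoArcCrossingPolynomial R δ ArcWiring.joint with hNdef
  set Z := fkTwoArcPartitionPolynomials R δ ArcWiring.joint with hZdef
  by_cases hZz : aeval z Z = 0
  · rw [hZz, div_zero, norm_zero]
    exact le_max_right _ _
  -- `Z(t) > 0` at the real point `t`, hence `Z ≠ 0` on a small ball around `t`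
  have hZt : aeval (t : ℂ) Z ≠ 0 := by
    rw [← ratioToCrux_ofReal_aeval_natPoly, Complex.ofReal_ne_zero]
    exact (ratioToCrux_aeval_partition_pos R hδ' ht0 _).ne'
  obtain ⟨ε, hε, hεZ⟩ : ∃ ε > (0:ℝ), ∀ w ∈ ball (t : ℂ) ε, aeval w Z ≠ 0 :=
    eventually_nhds_iff_ball.1
      (((Polynomial.differentiable_aeval Z) _).continuousAt.eventually_ne hZt)
  set f : ℂ → ℂ := fun w => aeval w N / aeval w Z with hfdef
  have hfd : DifferentiableOn ℂ f (ball (t : ℂ) ε) := fun w hw =>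
    (((Polynomial.differentiable_aeval N) w).div ((Polynomial.differentiable_aeval Z) w)
      (hεZ w hw)).differentiableWithinAt
  -- the bounded holomorphic extension `F` of `f` to `ball t r`
  obtain ⟨F, hFd, hFf, hFb⟩ :=
    derivBoundsToRatioBound_extension hε hr hfd (fun k => hδ k t ht)
  -- identity theorem on the convex ball: `F · Z = N` on `ball t r`
  set G : ℂ → ℂ := fun w => F w * aeval w Z - aeval w N with hGdef
  have hGd : DifferentiableOn ℂ G (ball (t : ℂ) r) :=
    (hFd.mul (Polynomial.differentiable_aeval Z).differentiableOn).sub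
      (Polynomial.differentiable_aeval N).differentiableOn
  have hG0 : G =ᶠ[𝓝 (t : ℂ)] 0 := by
    filter_upwards [hFf, ball_mem_nhds (t : ℂ) hε] with w hw hw'
    rw [Pi.zero_apply, hGdef]
    dsimp only
    rw [hw, hfdef]
    dsimp only
    rw [div_mul_cancel₀ _ (hεZ w hw'), sub_self]
  have hzr : z ∈ ball (t : ℂ) r := mem_ball.2 (hzt.trans (half_lt_self hr))
  have hGz : G z = 0 :=
    (hGd.analyticOnNhd isOpen_ball).eqOn_zero_of_preconnected_of_eventuallyEq_zero
      (convex_ball _ _).isPreconnected (mem_ball_self hr) hG0 hzr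
  have hFz : F z = aeval z N / aeval z Z := (eq_div_iff hZz).2 (sub_eq_zero.1 hGz)
  rw [← hFz]
  exact (hFb z hzt).trans (le_max_left _ _)

end Summit.CriticalPhenomena.CardyFormulaZ2.Cruxes.UniformAnalyticExtension.Birth
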